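import Summits.HodgeConjecture.HodgeConjecture.Theorems.HCCMUnconditionalH413OfFacts
import Summits.HodgeConjecture.CorCM.Hyp413.A3Liu413RogawskiFaceTypes
import Summits.HodgeConjecture.HodgeConjecture.Theorems.A3Liu413StubG2Holds
import Literature.NumberTheory.Automorphic.Liu2021.Prop413OccurrenceTransport
import Literature.NumberTheory.QuadraticForms.PrescribedNormClassesCM
import HarnessLib

/-!
# Crux `HCCMUnconditional.H413` (item stmt-HodgeConjecture-24833) — SKELETON LINE `rogawski_multone` v1.2 «carrier-free, print-guarded»
# (B-plan2 g4, director g4 BATCH 120/122/123 (T4) + RULINGS s49/s53 (E-III2), s41 HOLD = UNREGISTERED; SPEC `B-plan/ROG-SPEC.md` v1.2; v1 = 87cf52de3ef11a2f (tree), v1.1 = 778faac670e78fb3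
# (folder only: §0–§2 IMPORTED from the tree defs module `CorCM/Hyp413/A3Liu413RogawskiFaceTypes` = T4-τ0 ★ p633409); v1.2 = v1.1 with (E-III2) the two trace-formula stubs RE-TYPED to
# their PRINT-GUARDED twins `StubFTF1'` / `StubFTF2iff'` (τ0′ append, texts `B-plan/specs/E-III2-tau0prime.B-plan2g4.lean` 4aa25b2cc2c4fb25, REF1 reading PASS ×3 2026-08-28T13:04:43Z)
# and `stub_G2` CLOSED BY NAME (`stubG2_holds`, A-p05 ★ p634345) — 3 `sorry`s instead of 4, head unchanged)

The h413 leg of the floor reads EXACTLY three face-level Props (ROG-SPEC §0.1): **(E)** `StubDictionaryExistenceAtPin`, **(M≤)** `∀ face,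
multiplicity_le_one_printed` and **(O)** occurrence of every admissible `ω_t` — joined by the tree's `Hyp413Closing.hyp413_of_parts` /
`Prop413Data.multOneAsPrinted_of_rank_le_one_of_occursInH1` (all glue ★).  This line re-derives the three from ROGAWSKI'S THEOREMS FOR OUR
INNER FORM `G′ = U(V)` (signature `(2,1)` at `ι₁`, `(3,0)` at the other `N ≥ 2` real places; Rogawski's `D = M₃(E)`, `S₀` = the compact places):

* `stub_FTF1'`  — **F-TF1′ read through Matsushima, print-guarded (v1.2)** [Rogawski1990, §15.3 ¶1 pp. 249–250 (= Thm 13.3.6 (c) + §14.4)] ∘ [BorelWallach2000, VII 3.2;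
  Rogawski1990, Prop 15.2.1 (b)] ∘ [GelbartRogawski1991, Lemma 5.1.2; Liu2021, App. D l. 5241/5255]: every irreducible constituent of the PIN's
  `H¹_{B,τ′}` is `≅ ω_t` for a WEIGHT-ONE triple `t` with COFINITE `ε`-label (`EpsCofinite t`, Liu Def 4.11 l. 2088's proviso; admissibility is NOT part of this fact —
  it is DERIVED below from F-TF2′ + G2).
  Dictionary-level anchor already typed: `Rogawski1990.U3Spectrum.sec153_classification` / `thm32_iv` (posited carrier; B-typ01 census 3cdd94a2).
* `stub_FTF2le` — **F-TF2, «m(π) ≤ 1» half, read through Matsushima** [Rogawski1990, Thm 14.6.4 p. 244: `m(π) ∈ {0,1}` on `Π′(ξ)`] ∘ [Prop 15.2.1 (b):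
  `dim H¹(𝔤,K;J^±) = 1`] ∘ [`π_f ⇒ π` rigidity]: `rank Hom(ω_t, H¹_{B,τ′}) ≤ 1` for every weight-one `t`.  HONEST LABEL: ⊇ row III-J3a (its restriction to
  admissible `t`), re-anchored from the quasi-split Thm 13.3.1 to the inner-form Thm 14.6.4 — typed for completeness of the head, NEVER registered or offered to provers
  (it becomes a composite THEOREM only in v2 over the honest automorphic carrier).  Anchor typed: `U3Spectrum.rog1464_mult_le_one`, `U3MultiplicityOne.discrete_mult_le_one`.
* `stub_FTF2iff'` — **F-TF2′, Rogawski's CORRECTED parity rule, read through Matsushima, print-guarded (v1.2)** [Rogawski1990, Thm 14.6.4 + Rogawski1992 («[R₂]», the sign correction);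
  held restatements: GelbartRogawski1991 p. 446 L9–11, Marshall2014 §3.4, DimitrovRamakrishnan2015 Thm 3.2 (iii) = `U3Spectrum.thm32_iii`] ∘ [G2a: `πˢ(ξ_v) ↔` the
  non-standard `ψ_v`-class, GelbartRogawski1991 Lemma 5.1.2 / Cor 5.2.2] ∘ [G2c archimedean sign, Liu2021 Lem D.2 (2)]: for weight-one `t` WITH COFINITE `ε`-LABEL,
  `ω_t` OCCURS in `H¹_{B,τ′}` iff `Parity t` («`{v : ε_v ≠ 1}` finite and `#{v : ε_v ≠ 1} + #{φ ∈ Φ_μ : Im φ(δ) > 0}` even», `δ = (2·imagUnit)⁻¹` the pin's normalisation).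
* `stub_G2` — **the SIGN DICTIONARY** «`ε` is `μ`-admissible (Liu Def 4.12) ⟺ `Parity t`»: PROVABLE NOW — at the pin `Triple.IsAdmissible t` unfolds to the LHS of
  `Liu2021.isAdmissible_epsOf_iff_even` (A-p05, ★ p631997 — stated for ANY totally negative `d` and purely imaginary `δ`, so it fits the pin's `d = imagUnit²`,
  `δ = (2·imagUnit)⁻¹`) over the FIRST RUNG ★ p631334 `QuadraticForms.exists_prescribed_normClass_sign_iff_even` (B-p04; O'Meara 71:19/71:18/63:13a/65A); CLOSED BY NAME in v1.2 (rung R1: A-p05 ★ p634345 `stubG2_holds`, imported).  G2c (archimedean sign) is NOT a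
  v1 rung (decision 12:17:53Z): it lives inside `stub_FTF2iff'` here and inside (τ4) in v2.

HEAD (kernel-checked, no `sorry` outside the three stubs): `dictionaryExistenceAtPin_of : StubFTF1' → StubFTF2iff' → StubG2 → StubDictionaryExistenceAtPin`,
`occursAtPin_of : StubFTF2iff' → StubG2 → StubOccursAtPin` (the guard of F-TF2′ discharged by `epsCofinite_of_parity ∘ G2`), `multOneAtPin_of : StubFTF2le → StubOccursAtPin → StubMultOneAtPin`, and
**`H413_proof : HCCMUnconditional.H413`** with ZERO hypotheses via `hyp413_of_parts irredDecomposition_holds … Theorems.HD3_proof Theorems.HD1pp_proof`.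
Every stub is LOAD-BEARING (G2 twice).  WHY THE GUARD (v1.2): the unguarded `StubFTF2iff` quantifies over ALL `P.Triple`, incl. junk `ε` non-trivial at
infinitely many places, where `OccursInH1 … ↔ Parity` is refutable (REF1 12:49:36Z / ref3 13:04Z); print's theorems speak of automorphic `π = ⊗′π_v`, unramified a.e. —
exactly `EpsCofinite`; the head needs the iff only at triples that are either images of constituents (F-TF1′ supplies the guard) or admissible (G2 ⇒ Parity ⇒ guard).  Why F-TF1/F-TF2 are NAMED FACTS (size ∞): both rest on the stable trace formula for U(3) [Rogawski1990, Thm 10.3.1 ⇐ Ch. 2–12,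
14.3–14.6; FL (BR₁), (M)/(AC)]; none of that analysis exists in Mathlib or the tree (ROG-SPEC §2 TF CHAIN).  v2 («honest carrier», ROG-SPEC §2 τ1–τ3 / §3) turns the three
`StubFTF*` into theorems of {S1 Matsushima-at-pin, S2 (𝔤,K) census, F-TF1/F-TF2 single-source over the automorphic spectrum of `G′`, S4 local packets := Weil representations, G2a, G2c}.
HC_CM is proved only modulo the 7 printed citations until rung 0 closes; this file is a crux WORKFILE and changes no count.
-/

set_option autoImplicit false

noncomputable section

namespace Summit.HodgeConjecture.CorCM.Cruxes.H413.RogawskiMultone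

open scoped TensorProduct Matrix
open NumberField NumberField.InfinitePlace
open HodgeCM.Model HodgeCM.Model.LiuIndex HodgeCM.Model.TowerCarrier
open Summit.HodgeConjecture.CorCM.Model
open Literature.AlgebraicGeometry.Motives (CMType)
open Literature.AlgebraicGeometry.HodgeTheory Literature.NumberTheory.Automorphic.PicardCM
open Literature.AlgebraicGeometry.ShimuraVarieties Literature.AlgebraicGeometry.ShimuraVarieties.UnitaryCanonicalModel
open Literature.NumberTheory.ComplexMultiplication
open Literature.NumberTheory.Automorphic
open Literature.NumberTheory.Automorphic.Liu2021 Literature.NumberTheory.Automorphic.Liu2021.AppendixC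
open Literature.NumberTheory.Automorphic.Liu2021.Def411WeilCarriers (lineOf locF Rep)
open Summit.HodgeConjecture.CorCM.Transposition.OmegaTransport (realUnit)
open HodgeCM.Model.ArchSideTerm (e₁)
open Literature.NumberTheory.GelbartRogawski1991 Literature.NumberTheory.GelbartRogawski1991.UnitaryDualPair
open Literature.RepresentationTheory Literature.RepresentationTheory.Liu2021
open Summit.HodgeConjecture.CorCM.Transposition
open Summit.HodgeConjecture.CorCM.D2Bridge.MuKeyIdentLemD3DelRecConjOmegaEndT.PrintedCitationHypotheses (Hyp413 HypD3 HypD1pp)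
open Literature.NumberTheory.GelbartRogawski1991.OscillatorTripleDictionary (OccursInH1 IsIsoToOmega rhoTriple)
open scoped DirectSum
open Summit.HodgeConjecture.CorCM.Lines.A3Liu413
open Summit.HodgeConjecture.CorCM.Hyp413Closing

/-! ## §0–§2 (v1.1/v1.2) The pin `rfl`s, the parity predicate `Parity`, the stub TYPES `StubFTF1` / `StubFTF2le` / `StubFTF2iff` /
`StubG2` / `StubOccursAtPin` (τ0 ★ p633409) and the print-guarded twins `EpsCofinite` / `epsCofinite_of_parity` / `StubFTF1'` / `StubFTF2iff'` /
`stubFTF1_of_stubFTF1'` / `stubFTF2iff'_of_stubFTF2iff` (τ0′ append) now LIVE IN THE TREE as the defs module `Summits/HodgeConjecture/CorCM/Hyp413/A3Liu413RogawskiFaceTypes.lean`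
(B-typ01, T4-τ0; namespace `Summit.HodgeConjecture.CorCM.Lines.A3Liu413`, opened above; texts = v1 87cf52de3ef11a2f §0–§2 byte-for-byte, the
§0 `example`s named `datum413_Eps` / `datum413_epsOf` / `datum413_n`) so that Theorems closers (R1 `stubG2_holds`, A-p05) and the a3_liu413
registry (A-plan2 v10 fold) refer to the SAME constants as this skeleton; nothing is restated here. -/

/-! ## §3 STUBS (the ONLY `sorry`s of the file: `stub_FTF1'`, `stub_FTF2le`, `stub_FTF2iff'`; `stub_G2` is a THEOREM since ★ p634345 — see §2 of v1 for who registers what;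
this workfile is UNREGISTERED on item 24833 per director s41: the registry of record is fan A's `a3_liu413`, which folds these stub names) -/

/-- STUB (FACT ∞, trace formula): **F-TF1′ through Matsushima, PRINT-GUARDED** — every irreducible constituent of the pin's `H¹_{B,τ′}` is `≅ ω_t` for a
weight-one triple `t` WHOSE `ε`-LABEL IS COFINITE (`EpsCofinite t`: print's adèlic oscillator triples carry the proviso «`ε_v ∈ 𝓞^×·Nm` for almost all `v`» by
definition, [Liu2021, Def. 4.11 (l. 2088)]; the unprimed `StubFTF1` forgot it — certificate `stubFTF1_of_stubFTF1'`: ′ asks MORE of its prover).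
[cite: Rogawski1990, §15.3 (pp. 249–250)] [cite: GelbartRogawski1991, Thm. 5.1.1; Lemma 5.1.2] [cite: Liu2021, proof of Prop. 4.13 (l. 2145)] -/
theorem stub_FTF1' : StubFTF1' := by
  sorry

/-- STUB (FACT ∞, trace formula; ⊇ row III-J3a re-anchored — not a prover target in v1): F-TF2 `m ≤ 1` half through Matsushima (unguarded: `m ≤ 1` needs no proviso).
[cite: Rogawski1990, Thm. 14.6.4 (p. 244); Prop. 15.2.1 (b)] -/
theorem stub_FTF2le : StubFTF2le := by
  sorry

/-- STUB (FACT ∞, trace formula + the 1992 sign correction): **F-TF2′ parity rule through Matsushima, PRINT-GUARDED** — for weight-one `t` with COFINITE `ε`-label,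
`ω_t` occurs in `H¹_{B,τ′}` iff `Parity t`.  The guard `EpsCofinite t →` restricts the unprimed `StubFTF2iff` to print's carrier (automorphic `π = ⊗′π_v` are unramified
a.e., so their Liu label is cofinite); WITHOUT it the statement is refutable by a junk-`ε` weight-one triple (REF1 reading audit 2026-08-28T12:49:36Z, confirmed ref3
13:04Z) — certificate `stubFTF2iff'_of_stubFTF2iff`: ′ ≤ unprimed.  [cite: Rogawski1990, Thm. 14.6.4 (p. 244)] [cite: Rogawski1992, Thm. 1.1]
[cite: GelbartRogawski1991, p. 446 L9–11] [cite: Marshall2014, §3.4] -/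
theorem stub_FTF2iff' : StubFTF2iff' := by
  sorry

/-- **G2, the SIGN DICTIONARY — A THEOREM** (rung R1: A-p05 ★ p634345 `Theorems/A3Liu413StubG2Holds.lean`, over ★ p631997 `isAdmissible_epsOf_iff_even` and
★ p631334/p635374 `PrescribedNormClassesCM`): `ε` is `μ`-admissible (Liu Def. 4.12) ⟺ `Parity t`.  Kept under its v1 name so the head reads unchanged.
[cite: Liu2021, Def. 4.12] [cite: Omeara1963, 71:19] -/
theorem stub_G2 : StubG2 :=
  stubG2_holds

/-! ## §4 HEAD — kernel-checked compositions, no `sorry` below this line -/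

set_option synthInstance.maxHeartbeats 400000 in
set_option maxHeartbeats 8000000 in
/-- **(E) from F-TF1′ + F-TF2′ + G2.**  An irreducible constituent `σ` of `H¹_{B,τ′}` is `≅ ω_t` with `t` of weight one AND cofinite `ε`-label (F-TF1′);
transporting the non-zero intertwiner along the isomorphism (`Prop413Data.occursInH1_of_equiv`), `ω_t` occurs, so — the guard being available — `Parity t`
(F-TF2′ ⇒), so `ε` is `μ`-admissible (G2 ⇐): `t` is an admissible weight-one triple with `σ ≅ ω_V(t)` — the registered stub body `StubDictionaryExistenceAtPin`
of the crux.
[cite: Rogawski1990, §15.3; Thm. 14.6.4] [cite: Liu2021, proof of Prop. 4.13 (l. 2145); Def. 4.12] -/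
theorem dictionaryExistenceAtPin_of (h1 : StubFTF1') (h2 : StubFTF2iff') (hG2 : StubG2) : StubDictionaryExistenceAtPin := by
  intro hDel F _ h6 ι₁ V a₀ Φ hΦ i hn τ' W₀ _ _ σ hirr hocc
  obtain ⟨t, hfin, hw, f, hf⟩ := h1 hDel F h6 V a₀ Φ hΦ i hn τ' W₀ σ hirr hocc
  have hocc' : OccursInH1 (datum413 hDel F V a₀ Φ i) τ' (rhoTriple (datum413 hDel F V a₀ Φ i) t) :=
    Prop413Data.occursInH1_of_equiv f hf hocc
  have hadm : t.IsAdmissible :=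
    (hG2 hDel F h6 V a₀ Φ hΦ i t).mpr ((h2 hDel F h6 V a₀ Φ hΦ i hn τ' t hfin hw).mp hocc')
  exact ⟨⟨t, hw, hadm⟩, f, hf⟩

set_option synthInstance.maxHeartbeats 400000 in
set_option maxHeartbeats 8000000 in
/-- **(O) from F-TF2′ + G2.**  An admissible weight-one `t` has `Parity t` (G2 ⇒), hence a COFINITE `ε`-label (`epsCofinite_of_parity` — this is what makes the
guarded F-TF2′ applicable), hence `ω_t` occurs (F-TF2′ ⇐) — Rogawski's `m(π) = 1` in place of Rallis.
(`P.n = 3` by `rfl`; `P.rhoAt t = rhoTriple P t.1` by `rfl`.) [cite: Rogawski1990, Thm. 14.6.4] [cite: Liu2021, proof of Prop. 4.13 (l. 2145)] -/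
theorem occursAtPin_of (h2 : StubFTF2iff') (hG2 : StubG2) : StubOccursAtPin := by
  intro hDel F _ h6 ι₁ V a₀ Φ hΦ i _ τ' t
  have hpar : Parity hDel F V a₀ Φ i t.1 := (hG2 hDel F h6 V a₀ Φ hΦ i t.1).mp t.2.2
  exact (h2 hDel F h6 V a₀ Φ hΦ i rfl τ' t.1 (epsCofinite_of_parity hDel F V a₀ Φ i t.1 hpar) t.2.1).mpr hpar

set_option synthInstance.maxHeartbeats 400000 in
set_option maxHeartbeats 8000000 in
/-- **J3 (multiplicity EXACTLY one at the pin) from F-TF2's `m ≤ 1` half + (O)**, by `Prop413Data.multOneAsPrinted_of_rank_le_one_of_occursInH1`.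
[cite: Liu2021, proof of Prop. 4.13 (ll. 2131–2145)] [cite: Rogawski1990, Thm. 14.6.4] -/
theorem multOneAtPin_of (hle : StubFTF2le) (hocc : StubOccursAtPin) : StubMultOneAtPin := by
  intro hDel F _ h6 ι₁ V a₀ Φ hΦ i
  exact Prop413Data.multOneAsPrinted_of_rank_le_one_of_occursInH1
    (fun hn τ' t => hle hDel F h6 V a₀ Φ hΦ i hn τ' t.1 t.2.1) (hocc hDel F h6 V a₀ Φ hΦ i)

set_option synthInstance.maxHeartbeats 400000 in
set_option maxHeartbeats 8000000 in
/-- **HEAD OF THE LINE — the crux `HCCMUnconditional.H413` BY NAME, modulo EXACTLY the three stubs** {`stub_FTF1'`, `stub_FTF2le`, `stub_FTF2iff'`} (`stub_G2` is a theorem since ★ p634345):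
the analytic half (`irredDecomposition_holds`), the arithmetic half (`stubConstituentsTheta_of_existence_of_multOne_of_hypD3_hypD1pp`), the label rows `hD3`
(`Theorems.HD3_proof` ★) and `hD1''` (`Theorems.HD1pp_proof` ★) and the re-assembly `hyp413_of_parts` are THEOREMS of the tree.  ZERO hypotheses.
HC_CM is proved only modulo the 7 printed citations until rung 0 closes. [cite: Liu2021, Prop. 4.13; Rem. 4.14] [cite: Rogawski1990, §15.3; Thm. 14.6.4] -/
theorem H413_proof : Summit.HodgeConjecture.HodgeConjecture.Theses.HCCMUnconditional.H413 :=
  hyp413_of_parts irredDecomposition_holds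
    (fun hJ2a hJ3 hD3' hD1pp => stubConstituentsTheta_of_existence_of_multOne_of_hypD3_hypD1pp hJ2a hJ3 hD3' hD1pp)
    (dictionaryExistenceAtPin_of stub_FTF1' stub_FTF2iff' stub_G2)
    (multOneAtPin_of stub_FTF2le (occursAtPin_of stub_FTF2iff' stub_G2))
    Summit.HodgeConjecture.HodgeConjecture.Theorems.HD3_proof
    Summit.HodgeConjecture.HodgeConjecture.Theorems.HD1pp_proof

end Summit.HodgeConjecture.CorCM.Cruxes.H413.RogawskiMultone

end
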